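import Summits.PneNP.PneNP.Theses.MatroidTseitin
import Literature.Computability.MetaComplexity.GaussianWidthDepthFregeUpperBound
import HarnessLib

/-!
# PneNP / MatroidTseitin — `GaussianWidthDepthFregeUB` (stmt-PneNP-11428): the Gaussian-width
upper bound for bounded-depth Frege, closed

Route `PneNP/MatroidTseitin`, support item `GaussianWidthDepthFregeUB` (rank 9, "the conjecture's
upper half … calibration, provable now"): there are a fixed depth `d₀` and a constant `C` such that
every `ℓ`-sparse system over `𝔽₂` with a symmetric-difference derivation of an odd empty row sum all
of whose row sums have `≤ w` variables (Gaussian width `≤ w`) has a depth-`d₀` `textbookFrege` proof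
of `¬ ofCNF (sumEncoding 1 E)` of size `≤ (m+2)^C (n+2)^{C(w+ℓ)}`.

This file closes the item with `d₀ = 17`, `C = 58`, by the Literature theorem
`Literature.Computability.MetaComplexity.depthFrege_upperBound_of_rowSets`
(`GaussianWidthDepthFregeUpperBound.lean`; construction: parity DNFs of the derived equations,
each row's parity DNF from its clauses by one truth table over `≤ ℓ` variables, every genuinely
new line of the (deduplicated, `≤ 2(n+1)^w` lines) Gaussian refutation derived from the parity
DNFs of its `≤ 2` premises by one truth table over `≤ 2w` variables inside one carried conjunction,
the last line `0 = 1` rendering as `⊥`).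

Sources: E. Ben-Sasson, R. Impagliazzo, Comput. Complexity 19 (2010) (Gaussian width);
N. Galesi, D. Itsykson, A. Riazanov, A. Sofronova, APAL 174 (2023), §4 (the upper-bound
technique); the simulation itself is folklore (item docstring).
-/

set_option linter.dupNamespace false -- `Summit.PneNP.PneNP.…`: summit = sub-problem (D-0017)

namespace Summit.PneNP.PneNP.Theorems

/-- **`GaussianWidthDepthFregeUB` holds** (with `d₀ = 17`, `C = 58`): Gaussian width `≤ w` for an
`ℓ`-sparse system over `𝔽₂` gives depth-`17` `textbookFrege` refutations of its parity CNF of size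
`≤ (m+2)^{58} (n+2)^{58 (w+ℓ)}`. [cite: GalesiEtAl2023, §4 (upper bound technique)] -/
theorem matroidTseitin_gaussianWidthDepthFregeUB_proof :
    Summit.PneNP.PneNP.Theses.MatroidTseitin.GaussianWidthDepthFregeUB := by
  unfold Summit.PneNP.PneNP.Theses.MatroidTseitin.GaussianWidthDepthFregeUB
  refine ⟨17, 58, ?_⟩
  intro ℓ m n w E lc hE hS
  exact Literature.Computability.MetaComplexity.depthFrege_upperBound_of_rowSets ℓ m n w E hE hS

end Summit.PneNP.PneNP.Theorems
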